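import Mathlib
import HarnessLib
import Summits.NavierStokesRegularity.NavierStokesRegularity.Theses.IsobarTomography
import Summits.NavierStokesRegularity.NavierStokesRegularity.Theorems.IsobarTomographyTubeAlternativeStubOseenAncientAnalytic
import Summits.NavierStokesRegularity.NavierStokesRegularity.Theorems.IsobarTomographyTubeAlternativeStubDefectAnalyticOfVelocity
import Summits.NavierStokesRegularity.NavierStokesRegularity.Theorems.IsobarTomographyTubeAlternativeStubTwoSidedVorticityRate
import Summits.NavierStokesRegularity.NavierStokesRegularity.Theorems.IsobarTomographyTubeAlternativeStubPeakZoomPatch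
import Summits.NavierStokesRegularity.NavierStokesRegularity.Theorems.IsobarTomographyTubeAlternativeStubAntiBlobPeaks

/-!
# `TubeAlternative` (stmt-NavierStokesRegularity-11739), line `analytic-propagation-local-patch`:
# the REDUCTION of the crux to its bet (`stub_tubeAlternativeOfPeakActionDecay`)

Line `analytic-propagation-local-patch` (crux workfile
`Cruxes/TubeAlternative/Lines/analytic_propagation_local_patch.lean`) reduces the crux
`IsobarTomography.TubeAlternative` — at a Type-I singularity of a maximal Leray–Hopf classical solution
from a rapidly decaying datum where the blob hypothesis fails, some KNSS blow-up limit with classical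
pressure has isobaric vortex lines `⟪curl v, ∇q⟫ ≡ 0` and is not slice-wise constant — to ONE statement,
the line's bet **PeakActionDecay**: at such a singularity the scale-free isobaric ACTION
`ν⁻² ∫_{(t−1/|ω(t,x)|, t) × B(x, √(ν/|ω(t,x)|))} |⟪curl u, ∇p⟫|` is not bounded away from zero over the
late near-maximal vorticity peaks `(t, x)`. Every other step is LANDED (this line, 2026-08-16):

1. `stub_twoSidedVorticityRate` — Type-I ⇒ `c/(T−t) ≤ ‖ω(t)‖_∞ ≤ C/(T−t)` near `T`;
2. `stub_antiBlobPeaks` — `¬ blob`, tested with the threshold `θ·sup|ω|`, gives anti-blob near-max peaks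
   for every `κ > 0`, `θ < 1` (the hypothesis the bet consumes);
3. `stub_peakZoomPatch` — the vorticity-scale zoom at near-max peaks of vanishing action gives an
   Oseen-ancient KNSS limit with classical pressure, not slice-constant, isobaric on an open patch;
4. `stub_oseenAncientAnalytic` — bounded continuous Oseen-ancient fields are jointly real-analytic
   (Lemarié-Rieusset 2016 Thm 9.12 restarted at every `s < 0` + bounded uniqueness);
5. `stub_defectAnalyticOfVelocity` — analytic velocity + classical momentum equation ⇒ analytic defect;
6. the identity theorem on the preconnected slab `(-∞,0) × ℝ³` (`eqOn_zero_of_open_patch`).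

So `stub_tubeAlternativeOfPeakActionDecay : PeakActionDecay → TubeAlternative` below is sorry-free, and
the crux is exactly as hard as its bet. Granted the route's own K2 (`IsobaricLinesLiouville`) the bet is in
turn equivalent to "Type-I ∧ ¬blob is impossible" (`tubeAlternative_of_typeI_forces_blob`,
`blob_of_tubeAlternative_of_isobaricLinesLiouville`, file `IsobarTomographyTubeAlternativeGauge.lean`).
-/

noncomputable section

-- the summit and its single problem share the name (D-0017 nested layout)
set_option linter.dupNamespace false

open scoped InnerProductSpace RealInnerProductSpace
open Literature.Analysis.FluidPDE Set Function Filter MeasureTheory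
open _root_.Topology

namespace Summit.NavierStokesRegularity.NavierStokesRegularity.Theorems.TubeAlternative.AnalyticPropagation

/-- Physical space `ℝ³`. -/
local notation "E3" => EuclideanSpace ℝ (Fin 3)

/-- The identity theorem on the preconnected open slab: an analytic function on `(-∞,0) × ℝ³`
vanishing on a non-empty open subset vanishes on the slab (Mathlib
`AnalyticOnNhd.eqOn_zero_of_preconnected_of_eventuallyEq_zero`). [folklore] -/
theorem eqOn_zero_of_open_patch {F : ℝ × E3 → ℝ}
    (hA : AnalyticOnNhd ℝ F (Set.Iio 0 ×ˢ Set.univ))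
    {U : Set (ℝ × E3)} (hUo : IsOpen U) (hUne : U.Nonempty) (hUS : U ⊆ Set.Iio 0 ×ˢ Set.univ)
    (hU0 : ∀ z ∈ U, F z = 0) : ∀ z ∈ Set.Iio (0 : ℝ) ×ˢ (Set.univ : Set E3), F z = 0 := by
  obtain ⟨z₀, hz₀⟩ := hUne
  have hpre : IsPreconnected ((Set.Iio (0 : ℝ)) ×ˢ (Set.univ : Set E3)) :=
    isPreconnected_Iio.prod isPreconnected_univ
  have hev : F =ᶠ[𝓝 z₀] 0 := by
    filter_upwards [hUo.mem_nhds hz₀] with z hz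
    exact hU0 z hz
  exact hA.eqOn_zero_of_preconnected_of_eventuallyEq_zero hpre (hUS hz₀) hev

/-- The isobaric action is non-negative (integral of an absolute value). [folklore] -/
theorem isobaricAction_nonneg (ν : ℝ) (u : ℝ → E3 → E3) (p : ℝ → E3 → ℝ) (t : ℝ) (x : E3) :
    0 ≤ ν⁻¹ ^ 2 * ∫ z in (Set.Ioo (t - 1 / ‖curl (u t) x‖) t) ×ˢ
        Metric.ball x (Real.sqrt (ν / ‖curl (u t) x‖)),
        |⟪curl (u z.1) z.2, gradient (p z.1) z.2⟫| :=
  mul_nonneg (by positivity) (integral_nonneg fun _ => abs_nonneg _)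

/-- **The line's REDUCTION (registered as `stub_tubeAlternativeOfPeakActionDecay`): the bet implies the
crux `IsobarTomography.TubeAlternative`.** From the two-sided rate (1) and the anti-blob peaks (2),
the bet (the hypothesis) gives near-max peaks of action `< 1/(k+1)` at times `≥ T − 1/(k+1)`; the zoom (3) turns them
into an Oseen-ancient KNSS limit with classical pressure, not slice-constant, isobaric on an open patch;
its velocity is analytic (4), so is its defect (5); the identity theorem (6) on the preconnected slab
`(-∞,0) × ℝ³` spreads the patch to the whole slab. [folklore] -/
theorem stub_tubeAlternativeOfPeakActionDecay :
    (∀ (ν T : ℝ), 0 < ν → 0 < T → ∀ (u : ℝ → E3 → E3) (p : ℝ → E3 → ℝ),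
      IsMaximalSmoothSolution ν 0 u p T → IsLerayHopfOn T ν 0 (u 0) u →
      HasRapidSpatialDecay (u 0) → IsTypeIBlowup u T →
      (∀ κ θ : ℝ, 0 < κ → 0 < θ → θ < 1 → ∀ t₀ ∈ Set.Ico 0 T, ∃ t ∈ Set.Ico t₀ T, ∃ x : E3,
        0 < ‖curl (u t) x‖ ∧ (∀ y : E3, θ * ‖curl (u t) y‖ ≤ ‖curl (u t) x‖) ∧
        iteratedFDeriv ℝ 2 (p t) x ![curl (u t) x, curl (u t) x] <
          κ * ‖curl (u t) x‖ ^ 2 * Laplacian.laplacian (p t) x) →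
      ∀ η θ : ℝ, 0 < η → 0 < θ → θ < 1 → ∀ t₁ ∈ Set.Ico 0 T, ∃ t ∈ Set.Ico t₁ T, ∃ x : E3,
        0 < ‖curl (u t) x‖ ∧ (∀ y : E3, θ * ‖curl (u t) y‖ ≤ ‖curl (u t) x‖) ∧
        ν⁻¹ ^ 2 * (∫ z in (Set.Ioo (t - 1 / ‖curl (u t) x‖) t) ×ˢ
            Metric.ball x (Real.sqrt (ν / ‖curl (u t) x‖)),
            |⟪curl (u z.1) z.2, gradient (p z.1) z.2⟫|) < η) →
    Summit.NavierStokesRegularity.NavierStokesRegularity.Theses.IsobarTomography.TubeAlternative := by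
  intro h5b ν T hν hT u p hmax hLH hdec hI hnb
  -- (1) two-sided vorticity rate
  obtain ⟨c, C, hc, t₁, ht₁, hrate⟩ := stub_twoSidedVorticityRate ν T hν hT u p hmax hLH hdec hI
  -- (5a) anti-blob peaks from the failed blob hypothesis
  have h5a := stub_antiBlobPeaks ν T hν hT u p hmax hLH hdec hI hnb
  -- (5) near-max peaks with small action at cofinal times
  have hθ : (0 : ℝ) < 1 / 2 := by norm_num
  have hθ1 : (1 / 2 : ℝ) < 1 := by norm_num
  have hstart : ∀ k : ℕ, max t₁ (T - 1 / ((k : ℝ) + 1)) ∈ Set.Ico 0 T := fun k =>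
    ⟨ht₁.1.trans (le_max_left _ _), max_lt ht₁.2 (by
      have : (0 : ℝ) < 1 / ((k : ℝ) + 1) := by positivity
      linarith)⟩
  have key : ∀ k : ℕ, ∃ t ∈ Set.Ico (max t₁ (T - 1 / ((k : ℝ) + 1))) T, ∃ x : E3,
      0 < ‖curl (u t) x‖ ∧ (∀ y : E3, (1 / 2) * ‖curl (u t) y‖ ≤ ‖curl (u t) x‖) ∧
      ν⁻¹ ^ 2 * (∫ z in (Set.Ioo (t - 1 / ‖curl (u t) x‖) t) ×ˢ
          Metric.ball x (Real.sqrt (ν / ‖curl (u t) x‖)),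
          |⟪curl (u z.1) z.2, gradient (p z.1) z.2⟫|) < 1 / ((k : ℝ) + 1) := fun k =>
    h5b ν T hν hT u p hmax hLH hdec hI h5a (1 / ((k : ℝ) + 1)) (1 / 2)
      (by positivity) hθ hθ1 _ (hstart k)
  choose tk htk xk hpos hnear hact using key
  have htk₁ : ∀ k, tk k ∈ Set.Ico t₁ T := fun k =>
    ⟨(le_max_left _ _).trans (htk k).1, (htk k).2⟩
  have htend : Tendsto tk atTop (𝓝 T) := by
    have hlow : Tendsto (fun k : ℕ => T - 1 / ((k : ℝ) + 1)) atTop (𝓝 T) := by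
      have h1 : Tendsto (fun k : ℕ => 1 / ((k : ℝ) + 1)) atTop (𝓝 0) :=
        tendsto_one_div_add_atTop_nhds_zero_nat
      simpa using (tendsto_const_nhds (x := T)).sub h1
    refine tendsto_of_tendsto_of_tendsto_of_le_of_le hlow tendsto_const_nhds (fun k => ?_) (fun k => ?_)
    · exact (le_max_right _ _).trans (htk k).1
    · exact (htk k).2.le
  have haction : Tendsto (fun k => ν⁻¹ ^ 2 *
      ∫ z in (Set.Ioo (tk k - 1 / ‖curl (u (tk k)) (xk k)‖) (tk k)) ×ˢ
        Metric.ball (xk k) (Real.sqrt (ν / ‖curl (u (tk k)) (xk k)‖)),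
        |⟪curl (u z.1) z.2, gradient (p z.1) z.2⟫|) atTop (𝓝 0) := by
    have h1 : Tendsto (fun k : ℕ => 1 / ((k : ℝ) + 1)) atTop (𝓝 0) :=
      tendsto_one_div_add_atTop_nhds_zero_nat
    refine tendsto_of_tendsto_of_tendsto_of_le_of_le tendsto_const_nhds h1 (fun k => ?_) (fun k => ?_)
    · exact isobaricAction_nonneg ν u p (tk k) (xk k)
    · exact (hact k).le
  -- (2) the zoom
  obtain ⟨v, q, hv, hcl, hos, hnc, U, hUo, hUne, hUS, hU0⟩ :=
    stub_peakZoomPatch ν T hν hT u p hmax hLH hdec hI c C t₁ hc ht₁ hrate (1 / 2) hθ hθ1 tk xk htk₁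
      htend hpos hnear haction
  -- (3) analytic velocity, (4) analytic defect
  have hcont : ContinuousOn (uncurry v) (Set.Iio 0 ×ˢ Set.univ) := hcl.smooth_velocity.continuousOn
  have hbd : ∃ M : ℝ, ∀ t < 0, ∀ x : E3, ‖v t x‖ ≤ M := ⟨1, hv.norm_le_one⟩
  have hAv := stub_oseenAncientAnalytic v hcont hbd hos
  have hAF := stub_defectAnalyticOfVelocity v q hAv hcl
  -- identity theorem
  have hzero := eqOn_zero_of_open_patch hAF hUo hUne hUS hU0
  exact ⟨v, q, hv, hcl, fun t ht x => hzero (t, x) ⟨ht, Set.mem_univ _⟩, hnc⟩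

/-- **The reduction from the planner's ORIGINAL bet `PeakActionDecay`** (hypothesis: the crux's own
`¬ blob` instead of the anti-blob peaks of stub 5a; this statement is implied by the registered bet
`stub_peakActionDecayOfAntiBlobPeaks` via `stub_antiBlobPeaks`, and may be strictly weaker): it also
implies the crux `IsobarTomography.TubeAlternative`.** From the two-sided rate (1) and the anti-blob peaks (2),
the bet (the hypothesis) gives near-max peaks of action `< 1/(k+1)` at times `≥ T − 1/(k+1)`; the zoom (3) turns them
into an Oseen-ancient KNSS limit with classical pressure, not slice-constant, isobaric on an open patch;
its velocity is analytic (4), so is its defect (5); the identity theorem (6) on the preconnected slab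
`(-∞,0) × ℝ³` spreads the patch to the whole slab. [folklore] -/
theorem tubeAlternative_of_peakActionDecay :
    (∀ (ν T : ℝ), 0 < ν → 0 < T → ∀ (u : ℝ → E3 → E3) (p : ℝ → E3 → ℝ),
      IsMaximalSmoothSolution ν 0 u p T → IsLerayHopfOn T ν 0 (u 0) u →
      HasRapidSpatialDecay (u 0) → IsTypeIBlowup u T →
      (¬ ∃ κ : ℝ, 0 < κ ∧ ∃ Ω : ℝ → ℝ, ∃ t₀ ∈ Set.Ico 0 T, ∀ t ∈ Set.Ico t₀ T,
        (∃ x : E3, Ω t < ‖curl (u t) x‖) ∧ ∀ x : E3, Ω t < ‖curl (u t) x‖ →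
          κ * ‖curl (u t) x‖ ^ 2 * Laplacian.laplacian (p t) x ≤
            iteratedFDeriv ℝ 2 (p t) x ![curl (u t) x, curl (u t) x]) →
      ∀ η θ : ℝ, 0 < η → 0 < θ → θ < 1 → ∀ t₁ ∈ Set.Ico 0 T, ∃ t ∈ Set.Ico t₁ T, ∃ x : E3,
        0 < ‖curl (u t) x‖ ∧ (∀ y : E3, θ * ‖curl (u t) y‖ ≤ ‖curl (u t) x‖) ∧
        ν⁻¹ ^ 2 * (∫ z in (Set.Ioo (t - 1 / ‖curl (u t) x‖) t) ×ˢ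
            Metric.ball x (Real.sqrt (ν / ‖curl (u t) x‖)),
            |⟪curl (u z.1) z.2, gradient (p z.1) z.2⟫|) < η) →
    Summit.NavierStokesRegularity.NavierStokesRegularity.Theses.IsobarTomography.TubeAlternative := by
  intro hPAD ν T hν hT u p hmax hLH hdec hI hnb
  -- (1) two-sided vorticity rate
  obtain ⟨c, C, hc, t₁, ht₁, hrate⟩ := stub_twoSidedVorticityRate ν T hν hT u p hmax hLH hdec hI
  -- (5) near-max peaks with small action at cofinal times
  have hθ : (0 : ℝ) < 1 / 2 := by norm_num
  have hθ1 : (1 / 2 : ℝ) < 1 := by norm_num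
  have hstart : ∀ k : ℕ, max t₁ (T - 1 / ((k : ℝ) + 1)) ∈ Set.Ico 0 T := fun k =>
    ⟨ht₁.1.trans (le_max_left _ _), max_lt ht₁.2 (by
      have : (0 : ℝ) < 1 / ((k : ℝ) + 1) := by positivity
      linarith)⟩
  have key : ∀ k : ℕ, ∃ t ∈ Set.Ico (max t₁ (T - 1 / ((k : ℝ) + 1))) T, ∃ x : E3,
      0 < ‖curl (u t) x‖ ∧ (∀ y : E3, (1 / 2) * ‖curl (u t) y‖ ≤ ‖curl (u t) x‖) ∧
      ν⁻¹ ^ 2 * (∫ z in (Set.Ioo (t - 1 / ‖curl (u t) x‖) t) ×ˢ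
          Metric.ball x (Real.sqrt (ν / ‖curl (u t) x‖)),
          |⟪curl (u z.1) z.2, gradient (p z.1) z.2⟫|) < 1 / ((k : ℝ) + 1) := fun k =>
    hPAD ν T hν hT u p hmax hLH hdec hI hnb (1 / ((k : ℝ) + 1)) (1 / 2)
      (by positivity) hθ hθ1 _ (hstart k)
  choose tk htk xk hpos hnear hact using key
  have htk₁ : ∀ k, tk k ∈ Set.Ico t₁ T := fun k =>
    ⟨(le_max_left _ _).trans (htk k).1, (htk k).2⟩
  have htend : Tendsto tk atTop (𝓝 T) := by
    have hlow : Tendsto (fun k : ℕ => T - 1 / ((k : ℝ) + 1)) atTop (𝓝 T) := by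
      have h1 : Tendsto (fun k : ℕ => 1 / ((k : ℝ) + 1)) atTop (𝓝 0) :=
        tendsto_one_div_add_atTop_nhds_zero_nat
      simpa using (tendsto_const_nhds (x := T)).sub h1
    refine tendsto_of_tendsto_of_tendsto_of_le_of_le hlow tendsto_const_nhds (fun k => ?_) (fun k => ?_)
    · exact (le_max_right _ _).trans (htk k).1
    · exact (htk k).2.le
  have haction : Tendsto (fun k => ν⁻¹ ^ 2 *
      ∫ z in (Set.Ioo (tk k - 1 / ‖curl (u (tk k)) (xk k)‖) (tk k)) ×ˢ
        Metric.ball (xk k) (Real.sqrt (ν / ‖curl (u (tk k)) (xk k)‖)),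
        |⟪curl (u z.1) z.2, gradient (p z.1) z.2⟫|) atTop (𝓝 0) := by
    have h1 : Tendsto (fun k : ℕ => 1 / ((k : ℝ) + 1)) atTop (𝓝 0) :=
      tendsto_one_div_add_atTop_nhds_zero_nat
    refine tendsto_of_tendsto_of_tendsto_of_le_of_le tendsto_const_nhds h1 (fun k => ?_) (fun k => ?_)
    · exact isobaricAction_nonneg ν u p (tk k) (xk k)
    · exact (hact k).le
  -- (2) the zoom
  obtain ⟨v, q, hv, hcl, hos, hnc, U, hUo, hUne, hUS, hU0⟩ :=
    stub_peakZoomPatch ν T hν hT u p hmax hLH hdec hI c C t₁ hc ht₁ hrate (1 / 2) hθ hθ1 tk xk htk₁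
      htend hpos hnear haction
  -- (3) analytic velocity, (4) analytic defect
  have hcont : ContinuousOn (uncurry v) (Set.Iio 0 ×ˢ Set.univ) := hcl.smooth_velocity.continuousOn
  have hbd : ∃ M : ℝ, ∀ t < 0, ∀ x : E3, ‖v t x‖ ≤ M := ⟨1, hv.norm_le_one⟩
  have hAv := stub_oseenAncientAnalytic v hcont hbd hos
  have hAF := stub_defectAnalyticOfVelocity v q hAv hcl
  -- identity theorem
  have hzero := eqOn_zero_of_open_patch hAF hUo hUne hUS hU0
  exact ⟨v, q, hv, hcl, fun t ht x => hzero (t, x) ⟨ht, Set.mem_univ _⟩, hnc⟩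

end Summit.NavierStokesRegularity.NavierStokesRegularity.Theorems.TubeAlternative.AnalyticPropagation

end
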